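import Mathlib
import HarnessLib
import Summits.Ventures.LatticeQCDFlow.Exactness.SUNLeapfrogFTHMCErgodic
import Summits.Ventures.LatticeQCDFlow.Exactness.SUNLeapfrogHMCWilson

/-!
# Field-transformed single-step HMC for the `SU(N)` Wilson action, reported through any certified map, converges to the Wilson measure from every start

HONEST FRAMING: exact (Metropolis-corrected) sampling algorithms for lattice gauge theory;
figures of merit are autocorrelation/cost numbers at stated couplings and volumes; no
continuum-physics claim.

Venture `LatticeQCDFlow` (cell pub-lqcd), topic `Exactness`, FANOUT row 9 (eng-latcore; the field-
transformed / trivializing-map HMC of rows 14, 23–26 on the `SU(N)` Wilson action of the torus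
`(ℤ/L)^d`: run the engine's nstep = 1 leapfrog HMC for `β S_W ∘ F − log J` and report `U = F V`).
NEW WORK of the cell over the tree (`SUNLeapfrogFTHMCErgodic.lean`: uniform ergodicity of the
reported chain for every bounded measurable action and every measurable equivalence with pinched
measurable Jacobian; `SUNLeapfrogHMCWilson.lean`: `β S_W` is bounded, its Gibbs law is the Literature
`wilsonMeasure`); nothing is cited as a fact.

* **`wilson_sunLeapfrogFTHMC_uniformlyErgodic`** — torus `(ℤ/L)^d`, `G = SU(N)` (`N ≥ 1`),
  continuous representation `ρ`, any real `β`, step `ε > 0`, the engine's momenta and kinetic term,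
  ANY measurable momentum increment bounded by `b ≥ 0`, ANY measurable equivalence `F` of the
  configuration space with `HasJacobian Haar^⊗ F J`, `0 < j₁ ≤ J ≤ j₂` measurable: there are `k` and
  `δ ∈ (0, 1]` with `|μ₀K̃ᵗ(A) − wilsonMeasure ρ β (A)| ≤ (1 − δ)^{⌊t/(k+1)⌋}` for EVERY initial law;
* **`wilsonMeasure_unique_invariant_sunLeapfrogFTHMC`** — the Wilson measure is the ONLY invariant
  probability law of the reported kernel.

NOT CLAIMED: `nstep ≥ 2`, OMF words, `tau_jitter`; any usable constant; floating point; which maps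
`F` the engine certifies.
-/

noncomputable section

namespace Summit.Ventures.LatticeQCDFlow.Exactness

open MeasureTheory ProbabilityTheory ProbabilityTheory.Kernel Set
open Literature.MathematicalPhysics.QuantumFieldTheory
open scoped ENNReal

section Wilson

variable (N : ℕ) [NeZero N] {d L M : ℕ} (ρ : Matrix.specialUnitaryGroup (Fin N) ℂ →* Matrix (Fin M) (Fin M) ℂ)
  {F : GaugeConfig d L (Matrix.specialUnitaryGroup (Fin N) ℂ) ≃ᵐ GaugeConfig d L (Matrix.specialUnitaryGroup (Fin N) ℂ)}
  {J : GaugeConfig d L (Matrix.specialUnitaryGroup (Fin N) ℂ) → ℝ} {j₁ j₂ : ℝ}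

/-- **FIELD-TRANSFORMED SINGLE-STEP HMC FOR THE `SU(N)` WILSON ACTION CONVERGES TO THE WILSON MEASURE
FROM EVERY START**, reported through any measurable equivalence `F` with pinched measurable Jacobian. -/
theorem wilson_sunLeapfrogFTHMC_uniformlyErgodic [NeZero L] (hρ : Continuous ρ) (β : ℝ) {ε : ℝ} (hε : 0 < ε)
    {g : GaugeConfig d L (Matrix.specialUnitaryGroup (Fin N) ℂ) → Edge d L → SUNCoords N}
    (hg : Measurable g) {b : ℝ} (hb0 : 0 ≤ b) (hb : ∀ U e, ‖g U e‖ ≤ b)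
    (hj₁ : 0 < j₁) (hJ₁ : ∀ v, j₁ ≤ J v) (hJ₂ : ∀ v, J v ≤ j₂) (hJm : Measurable J)
    (hF : HasJacobian (Measure.pi fun _ : Edge d L => haarProbability (Matrix.specialUnitaryGroup (Fin N) ℂ)) F
      fun v => ENNReal.ofReal (J v)) :
    ∃ k : ℕ, ∃ δ : ℝ, 0 < δ ∧ δ ≤ 1 ∧
      ∀ (μ₀ : Measure (GaugeConfig d L (Matrix.specialUnitaryGroup (Fin N) ℂ))) [IsProbabilityMeasure μ₀]
        (t : ℕ) (A : Set (GaugeConfig d L (Matrix.specialUnitaryGroup (Fin N) ℂ))),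
        |((fun m : Measure (GaugeConfig d L (Matrix.specialUnitaryGroup (Fin N) ℂ)) =>
              m.bind (conjKernel (sunLeapfrogHMC (sunCoordι N) (sunCoordι_skew N)
                (Measure.addHaar : Measure (SUNCoords N)) (sunKinetic N) ε hg
                fun V => β * wilsonAction ρ (F V) - Real.log (J V)) F))^[t] μ₀).real A
            - (wilsonMeasure (d := d) (L := L) ρ β).real A| ≤ (1 - δ) ^ (t / (k + 1)) := by
  obtain ⟨s, hs⟩ := exists_bound_smul_wilsonAction_sun N (d := d) (L := L) ρ hρ β
  rw [← gibbsProbability_smul_wilsonAction_eq N (d := d) (L := L) ρ β]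
  exact engine_sunLeapfrogFTHMC_uniformlyErgodic N (S := fun U => β * wilsonAction ρ U) hε hg hb0 hb
    (continuous_smul_wilsonAction ρ hρ β).measurable hs hj₁ hJ₁ hJ₂ hJm hF

/-- **The Wilson measure is the unique invariant probability law of the reported FT-HMC kernel** (same
hypotheses). -/
theorem wilsonMeasure_unique_invariant_sunLeapfrogFTHMC [NeZero L] (hρ : Continuous ρ) (β : ℝ) {ε : ℝ}
    (hε : 0 < ε) {g : GaugeConfig d L (Matrix.specialUnitaryGroup (Fin N) ℂ) → Edge d L → SUNCoords N}
    (hg : Measurable g) {b : ℝ} (hb0 : 0 ≤ b) (hb : ∀ U e, ‖g U e‖ ≤ b)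
    (hj₁ : 0 < j₁) (hJ₁ : ∀ v, j₁ ≤ J v) (hJ₂ : ∀ v, J v ≤ j₂) (hJm : Measurable J)
    (hF : HasJacobian (Measure.pi fun _ : Edge d L => haarProbability (Matrix.specialUnitaryGroup (Fin N) ℂ)) F
      fun v => ENNReal.ofReal (J v))
    {π' : Measure (GaugeConfig d L (Matrix.specialUnitaryGroup (Fin N) ℂ))} [IsProbabilityMeasure π']
    (hπ' : Invariant (conjKernel (sunLeapfrogHMC (sunCoordι N) (sunCoordι_skew N)
      (Measure.addHaar : Measure (SUNCoords N)) (sunKinetic N) ε hg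
      fun V => β * wilsonAction ρ (F V) - Real.log (J V)) F) π') :
    π' = wilsonMeasure (d := d) (L := L) ρ β := by
  obtain ⟨s, hs⟩ := exists_bound_smul_wilsonAction_sun N (d := d) (L := L) ρ hρ β
  rw [← gibbsProbability_smul_wilsonAction_eq N (d := d) (L := L) ρ β]
  exact engine_sunLeapfrogFTHMC_invariant_unique N (S := fun U => β * wilsonAction ρ U) hε hg hb0 hb
    (continuous_smul_wilsonAction ρ hρ β).measurable hs hj₁ hJ₁ hJ₂ hJm hF hπ'

end Wilson

end Summit.Ventures.LatticeQCDFlow.Exactness
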